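import Summits.AtomisticToContinuum.Crystallization.Theorems.HolmgrenBoyleLindHalfSpaceUniqueContinuationThickDefect
import Summits.AtomisticToContinuum.Crystallization.Theorems.HolmgrenBoyleLindHalfSpaceUniqueContinuationBarlowStackingUC
import Summits.AtomisticToContinuum.Crystallization.Theorems.HolmgrenBoyleLindHalfSpaceUniqueContinuationRecurrentColumns

/-!
# Route `HolmgrenBoyleLind`: Lennard-Jones force fields of separated sources, part 9 —
finite registries: a thick registry class; recurrent registries
Support file for the crux item stmt-AtomisticToContinuum-6075 (`HalfSpaceUniqueContinuation`, line
`registered`: infrastructure for its layered core `stub_layeredOpenVanishing`, written by a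
stub-worker of lead c2), continuing parts 6–8 (`hbl_eq_of_thick_normal_lines`,
`hbl_thick_of_bounded_gaps`, `hbl_not_summable_inv_of_le_linear`, `hbl_exists_thick_letter`,
`hbl_eq_of_recurrent_columns`). REGISTRIES: the atoms lie on the columns `p + ℓ + ℝ u`, `p` in a
finite set `P` of registry classes, `ℓ` in a set `S` of horizontal translations (`⟪ℓ, u⟫ = 0`)
leaving `ω` invariant (`x + ℓ ∈ ω ↔ x ∈ ω`).

* `hbl_exists_thick_registry` — pigeonhole: if `ω` is `r`-dense and registered over `(P, S)`
  below the plane `{⟪z, u⟫ < a}`, then beyond any depth `T₀` some class `p ∈ P` is THICK: its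
  column carries an injective row `p − tₙ u ∈ ω`, `tₙ ≥ T₀`, with `Σ 1/tₙ = ∞` (the observers near
  the centres `−(M + 3 r n) u` form a harmonic row, which splits over the finitely many classes);
* `hbl_layered_eq_of_recurrent_registries` — two `δ`-separated balanced sets agreeing on
  `{⟪z, u⟫ < a}`, registered over `(P, S)` with `S` leaving `ω` invariant, are EQUAL as soon as
  the column of every class `p ∈ P` is recurrent in `ω` (bounded gaps beyond some depth): every
  column `x − ℝ u`, `x = p + ℓ + σ u ∈ ω ∪ ω'`, is then recurrent (translate the row of `p` by
  `ℓ`), and `hbl_eq_of_recurrent_columns` applies.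
All `[folklore]`; nothing here closes an item.
-/

noncomputable section
namespace Summit.AtomisticToContinuum.Crystallization.Theorems.HolmgrenBoyleLind

open scoped BigOperators Topology InnerProductSpace
open Literature.MathematicalPhysics.StatisticalMechanics
open Summit.AtomisticToContinuum.Crystallization.Theorems

/-- **A thick registry class (pigeonhole).** Let `ω ⊂ ℝ³` be `r`-dense (`r > 0`), `u` a unit
vector, and suppose every point of `ω` below the plane `{⟪z, u⟫ < a}` is REGISTERED:
`x = p + ℓ + σ u` with `p` in the finite set `P`, `ℓ ∈ S` horizontal (`⟪ℓ, u⟫ = 0`), `S` leaving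
`ω` invariant (`x + ℓ ∈ ω ↔ x ∈ ω`). Then for every depth `T₀` some class `p ∈ P` is thick: its
column carries an injective row `p − tₙ u ∈ ω`, `tₙ ≥ T₀`, with `Σ 1/tₙ = ∞`. Proof: the
observers `yₙ ∈ ω` within `r` of the centres `−(M + 3 r n) u`, `M = |T₀| + B + |a| + r + 1`
(`B` bounding `|⟪p, u⟫|` on `P`), lie below the plane; `yₙ = pₙ + ℓₙ + σₙ u` gives
`pₙ + σₙ u = yₙ − ℓₙ ∈ ω`, a row `tₙ = −σₙ = ⟪pₙ, u⟫ − ⟪yₙ, u⟫` with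
`M + 3 r n − r − B ≤ tₙ ≤ M + 3 r n + r + B`: harmonic (`hbl_not_summable_inv_of_le_linear`) and
injective on each class (windows `2 r` wide, `3 r` apart). The finitely many classes split
`Σ 1/tₙ = ∞`, so one class carries a non-summable sub-row, whose (infinite) index set is
enumerated by `Nat.nth` — the technique of `hbl_exists_thick_letter`. [folklore] -/
theorem hbl_exists_thick_registry :
    ∀ (ω : Set (EuclideanSpace ℝ (Fin 3))) (r : ℝ), 0 < r →
      (∀ c : EuclideanSpace ℝ (Fin 3), ∃ y ∈ ω, dist y c ≤ r) →
    ∀ (u : EuclideanSpace ℝ (Fin 3)) (a : ℝ), ‖u‖ = 1 →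
    ∀ (P : Finset (EuclideanSpace ℝ (Fin 3))) (S : Set (EuclideanSpace ℝ (Fin 3))),
      (∀ ℓ ∈ S, inner ℝ ℓ u = 0) →
      (∀ ℓ ∈ S, ∀ x : EuclideanSpace ℝ (Fin 3), x + ℓ ∈ ω ↔ x ∈ ω) →
      (∀ x ∈ ω, inner ℝ x u < a → ∃ p ∈ P, ∃ ℓ ∈ S, ∃ σ : ℝ, x = p + ℓ + σ • u) →
      ∀ T₀ : ℝ, ∃ p ∈ P, ∃ t : ℕ → ℝ, (∀ n : ℕ, T₀ ≤ t n) ∧ Function.Injective t ∧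
        ¬ Summable (fun n : ℕ => (t n)⁻¹) ∧ ∀ n : ℕ, p - t n • u ∈ ω := by
  intro ω r hr hdense u a hu P S hS0 hSinv hreg T₀
  classical
  -- a bound `B` on the heights of the classes and the depth scale `M`
  obtain ⟨B, hB0, hBP⟩ : ∃ B : ℝ, 0 ≤ B ∧ ∀ q ∈ P, |⟪q, u⟫_ℝ| ≤ B :=
    ⟨∑ q ∈ P, |⟪q, u⟫_ℝ|, Finset.sum_nonneg fun q _ => abs_nonneg _, fun q hq =>
      Finset.single_le_sum (f := fun q => |⟪q, u⟫_ℝ|) (fun q _ => abs_nonneg _) hq⟩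
  obtain ⟨M, hM⟩ : ∃ M : ℝ, M = |T₀| + B + |a| + r + 1 := ⟨_, rfl⟩
  -- observers `y n ∈ ω` within `r` of the centres `-(M + 3 r n) • u`; they lie below the plane
  have hobs : ∀ n : ℕ, ∃ y ∈ ω, dist y ((-(M + 3 * r * n)) • u) ≤ r := fun n => hdense _
  choose y hyω hydist using hobs
  have hyu : ∀ n : ℕ, |⟪y n, u⟫_ℝ + (M + 3 * r * n)| ≤ r := by
    intro n
    have h1 : ⟪y n - (-(M + 3 * r * n)) • u, u⟫_ℝ = ⟪y n, u⟫_ℝ + (M + 3 * r * n) := by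
      rw [inner_sub_left, real_inner_smul_left, real_inner_self_eq_norm_sq, hu]
      ring
    rw [← h1]
    refine (abs_real_inner_le_norm _ _).trans ?_
    rw [hu, mul_one, ← dist_eq_norm]
    exact hydist n
  have hya : ∀ n : ℕ, ⟪y n, u⟫_ℝ < a := by
    intro n
    have h1 := (abs_le.1 (hyu n)).2
    have h2 : (0 : ℝ) ≤ 3 * r * n := by positivity
    have h3 := neg_abs_le a
    have h4 := abs_nonneg T₀
    linarith
  -- registries of the observers: `y n = p n + ℓ n + σ n • u`
  have hdec : ∀ n : ℕ, ∃ p ∈ P, ∃ ℓ ∈ S, ∃ σ : ℝ, y n = p + ℓ + σ • u :=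
    fun n => hreg _ (hyω n) (hya n)
  choose p hpP ℓ hℓS σ hyeq using hdec
  -- the row `t n = ⟪p n, u⟫ - ⟪y n, u⟫ = -σ n`, with `p n - t n • u = y n - ℓ n ∈ ω`
  obtain ⟨t, ht⟩ : ∃ t : ℕ → ℝ, ∀ n, t n = ⟪p n, u⟫_ℝ - ⟪y n, u⟫_ℝ := ⟨_, fun n => rfl⟩
  have hσ : ∀ n, σ n = -t n := by
    intro n
    have h1 : ⟪y n, u⟫_ℝ = ⟪p n, u⟫_ℝ + ⟪ℓ n, u⟫_ℝ + σ n := by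
      rw [hyeq n, inner_add_left, inner_add_left, real_inner_smul_left,
        real_inner_self_eq_norm_sq, hu]
      ring
    rw [hS0 _ (hℓS n)] at h1
    rw [ht n]
    linarith
  have htω : ∀ n, p n - t n • u ∈ ω := by
    intro n
    refine (hSinv _ (hℓS n) _).1 ?_
    have h1 : p n - t n • u + ℓ n = y n := by
      rw [hyeq n, hσ n, neg_smul]
      abel
    rw [h1]
    exact hyω n
  -- the row is harmonic: `M + 3 r n - r - B ≤ t n ≤ M + 3 r n + r + B`
  have hpB : ∀ n, |⟪p n, u⟫_ℝ| ≤ B := fun n => hBP _ (hpP n)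
  have htlo : ∀ n : ℕ, |T₀| + |a| + 1 + 3 * r * n ≤ t n := by
    intro n
    have h1 := (abs_le.1 (hyu n)).2
    have h2 := (abs_le.1 (hpB n)).1
    rw [ht n]
    linarith
  have hthi : ∀ n : ℕ, t n ≤ (M + r + B) + (3 * r) * n := by
    intro n
    have h1 := (abs_le.1 (hyu n)).1
    have h2 := (abs_le.1 (hpB n)).2
    rw [ht n]
    linarith
  have hT₀ : ∀ n, T₀ ≤ t n := fun n => by
    have h1 := htlo n
    have h2 : (0 : ℝ) ≤ 3 * r * n := by positivity
    linarith [le_abs_self T₀, abs_nonneg a]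
  have ht1 : ∀ n, 1 ≤ t n := fun n => by
    have h1 := htlo n
    have h2 : (0 : ℝ) ≤ 3 * r * n := by positivity
    linarith [abs_nonneg T₀, abs_nonneg a]
  have hnot : ¬ Summable (fun n => (t n)⁻¹) :=
    hbl_not_summable_inv_of_le_linear (by linarith [abs_nonneg T₀, abs_nonneg a]) (by positivity)
      ht1 hthi
  -- pigeonhole: the classes split the harmonic row; one class `q` carries a non-summable part
  obtain ⟨q, hqP, hq⟩ : ∃ q ∈ P, ¬ Summable ({n : ℕ | p n = q}.indicator fun n => (t n)⁻¹) := by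
    by_contra hall
    push Not at hall
    refine hnot ((summable_sum (f := fun q => {n : ℕ | p n = q}.indicator fun n => (t n)⁻¹)
      (s := P) fun q hq => hall q hq).congr fun n => ?_)
    rw [Finset.sum_eq_single_of_mem (p n) (hpP n) fun q _ hqn => ?_]
    · exact Set.indicator_of_mem (by simp) _
    · exact Set.indicator_of_notMem (by simpa using (Ne.symm hqn)) _
  -- the class of `q` is infinite; enumerate it by `g = Nat.nth`
  set A : Set ℕ := {n : ℕ | p n = q}
  have hAinf : A.Infinite := by
    intro hfin
    refine hq (summable_of_hasFiniteSupport ?_)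
    change (Function.support (A.indicator fun n => (t n)⁻¹)).Finite
    exact hfin.subset Set.support_indicator_subset
  have hAinf' : (setOf fun m => m ∈ A).Infinite := by simpa using hAinf
  obtain ⟨g, hginj, hgA, hgrange⟩ : ∃ g : ℕ → ℕ, Function.Injective g ∧ (∀ n, p (g n) = q) ∧
      ∀ x ∉ Set.range g, A.indicator (fun n => (t n)⁻¹) x = 0 := by
    refine ⟨Nat.nth (· ∈ A), Nat.nth_injective hAinf', fun n => Nat.nth_mem_of_infinite hAinf' n,
      fun x hx => ?_⟩
    rw [Nat.range_nth_of_infinite hAinf'] at hx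
    exact Set.indicator_of_notMem hx _
  refine ⟨q, hqP, fun n => t (g n), fun n => hT₀ (g n), ?_, ?_, fun n => ?_⟩
  · -- injective: on one class the row lies in disjoint windows (`2 r` wide, `3 r` apart)
    intro m n hmn
    change t (g m) = t (g n) at hmn
    by_contra hne
    have hgmn : g m ≠ g n := fun h => hne (hginj h)
    have e1 := ht (g m)
    have e2 := ht (g n)
    rw [hgA m] at e1
    rw [hgA n] at e2
    obtain ⟨b1, b1'⟩ := abs_le.1 (hyu (g m))
    obtain ⟨b2, b2'⟩ := abs_le.1 (hyu (g n))
    rcases lt_or_gt_of_ne hgmn with hlt | hlt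
    · have h1 : (g m : ℝ) + 1 ≤ g n := by exact_mod_cast hlt
      have h2 : 3 * r * ((g m : ℝ) + 1) ≤ 3 * r * (g n : ℝ) :=
        mul_le_mul_of_nonneg_left h1 (by positivity)
      linarith
    · have h1 : (g n : ℝ) + 1 ≤ g m := by exact_mod_cast hlt
      have h2 : 3 * r * ((g n : ℝ) + 1) ≤ 3 * r * (g m : ℝ) :=
        mul_le_mul_of_nonneg_left h1 (by positivity)
      linarith
  · -- not summable: the sub-row is the non-summable part of the class `q`
    intro hsum
    refine hq ((hginj.summable_iff hgrange).1 (hsum.congr fun n => ?_))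
    rw [Function.comp_apply, Set.indicator_of_mem (show g n ∈ A from hgA n)]
  · -- membership
    have h := htω (g n)
    rw [hgA n] at h
    exact h

/-- **Layered unique continuation from recurrent registries.** Let `ω, ω' ⊂ ℝ³` be
`δ`-separated, both in exact Lennard-Jones force balance, agreeing on the open half-space
`{⟪z, u⟫ < a}` (`u` a unit vector). Suppose both are REGISTERED over `(P, S)`: every
`x ∈ ω ∪ ω'` is `p + ℓ + σ u` with `p ∈ P`, `ℓ ∈ S`, where the translations `ℓ ∈ S` (horizontal,
`⟪ℓ, u⟫ = 0`) leave `ω` invariant (`x + ℓ ∈ ω ↔ x ∈ ω`); and suppose the column of every class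
`p ∈ P` is recurrent in `ω`: beyond some `T₀` every window `[T, T + G]` holds a point
`p − τ u ∈ ω`. Then `ω = ω'`. Proof: the column of `x = p + ℓ + σ u` through `x − τ u =
(p − (τ − σ) u) + ℓ` is the `ℓ`-translate of the column of `p`, hence recurrent beyond `T₀ + σ`
with the same gap bound, and `hbl_eq_of_recurrent_columns` (bounded gaps ⇒ thick,
`hbl_thick_of_bounded_gaps`; thick below every defect ⇒ equal, `hbl_eq_of_thick_normal_lines`)
applies. The horizontality of `S` is not used. [folklore] -/
theorem hbl_layered_eq_of_recurrent_registries :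
    ∀ (ω ω' : Set (EuclideanSpace ℝ (Fin 3))) (δ : ℝ), 0 < δ →
      (∀ a ∈ ω, ∀ b ∈ ω, a ≠ b → δ ≤ dist a b) →
      (∀ a ∈ ω', ∀ b ∈ ω', a ≠ b → δ ≤ dist a b) →
      (∀ x ∈ ω, HasSum (fun y : {y : EuclideanSpace ℝ (Fin 3) // y ∈ ω ∧ y ≠ x} =>
        (deriv Literature.MathematicalPhysics.StatisticalMechanics.lennardJones (dist x y) / dist x y) •
          (x - (y : EuclideanSpace ℝ (Fin 3)))) 0) →
      (∀ x ∈ ω', HasSum (fun y : {y : EuclideanSpace ℝ (Fin 3) // y ∈ ω' ∧ y ≠ x} =>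
        (deriv Literature.MathematicalPhysics.StatisticalMechanics.lennardJones (dist x y) / dist x y) •
          (x - (y : EuclideanSpace ℝ (Fin 3)))) 0) →
      ∀ (u : EuclideanSpace ℝ (Fin 3)) (a : ℝ), ‖u‖ = 1 →
      (∀ z : EuclideanSpace ℝ (Fin 3), inner ℝ z u < a → (z ∈ ω ↔ z ∈ ω')) →
    ∀ (P : Finset (EuclideanSpace ℝ (Fin 3))) (S : Set (EuclideanSpace ℝ (Fin 3))),
      (∀ ℓ ∈ S, inner ℝ ℓ u = 0) →
      (∀ ℓ ∈ S, ∀ x : EuclideanSpace ℝ (Fin 3), x + ℓ ∈ ω ↔ x ∈ ω) →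
      (∀ x ∈ ω ∪ ω', ∃ p ∈ P, ∃ ℓ ∈ S, ∃ σ : ℝ, x = p + ℓ + σ • u) →
      (∀ p ∈ P, ∃ T₀ G : ℝ, 0 ≤ G ∧ ∀ T : ℝ, T₀ ≤ T →
        ∃ τ : ℝ, T ≤ τ ∧ τ ≤ T + G ∧ p - τ • u ∈ ω) →
      ω = ω' := by
  intro ω ω' δ hδ hsep hsep' hbal hbal' u a hu hagree P S _ hSinv hreg hclass
  refine hbl_eq_of_recurrent_columns ω ω' δ hδ hsep hsep' hbal hbal' u a hu hagree fun x hx => ?_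
  -- `x = p + ℓ + σ • u`; the column of `p` is recurrent beyond `T₀` with gaps `≤ G`
  obtain ⟨p, hpP, ℓ, hℓS, σ, hxe⟩ := hreg x hx
  obtain ⟨T₀, G, hG, hrow⟩ := hclass p hpP
  refine ⟨T₀ + σ, G, hG, fun T hT => ?_⟩
  obtain ⟨τ, hτ1, hτ2, hτω⟩ := hrow (T - σ) (by linarith)
  refine ⟨τ + σ, by linarith, by linarith, ?_⟩
  -- `x - (τ + σ) • u = (p - τ • u) + ℓ ∈ ω` by `S`-invariance
  have hpt : x - (τ + σ) • u = p - τ • u + ℓ := by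
    rw [hxe, add_smul]
    abel
  rw [hpt]
  exact (hSinv ℓ hℓS _).2 hτω

end Summit.AtomisticToContinuum.Crystallization.Theorems.HolmgrenBoyleLind

end
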